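import Summits.BirchSwinnertonDyer.Rank1Residual.Additive.GordRankZeroKatoComponent
import HarnessLib

/-!
# The (G)-cell at analytic rank `0`, EVERY defect `e ∈ {2,3,4,6}`: ONE typed cyclotomic input —
# "`char X(E/ℚ_∞)` contains an element with constant term `∼ L(E,1)/Ω_E`" — its consumer, and its
# DISCHARGE on the defect-2 rows (cell `b2b-bsdres`, sub-cell additive-p2, gen 13)

HONEST FRAMING (cell `b2b-bsdres`, run/shared/lean/b2b/bsd-rank1-residual/, verbatim in every
file): the goal of the cell is to DELETE the COMBINATION-SHAPED residual classes of the
Birch–Swinnerton-Dyer formula for ALL analytic-rank `≤ 1` elliptic curves over `ℚ` — "full BSD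
formula for every rank `≤ 1` curve in class `C`" assembled STRICTLY from published theorems — so
that the rank-`≤ 1` remainder becomes exactly the CONSTRUCTION-SHAPED classes, which are TYPED
(missing-input `Prop`s), NOT attempted. This is not "finishing BSD". Sub-cell `additive-p2`
(CLASS-OWNERS row "X3/X4 additive — pot. good ordinary / X3♯(G-ord)"), generation 13: research
route; no claim beyond the stated classes; X3♯(G-ord)/X4♯(G-ord) stay CONSTRUCTION-SHAPED; labels /
census / located gap UNCHANGED; nothing is booked. One definition (a typed input, nothing asserted)
and theorems; no new named fact.

## What and why

Through gen 12 the rank-`0` UPPER half `ord_p #Ш(E) ≤ ord_p #Ш_an(E)` on the (G)-ordinary cell was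
reached only on the DEFECT-2 rows (Kodaira `I₀*`, `E ≅ E♭ ⊗ χ_{p*}`), through the `χ_p`-branch of the
`p`-adic `L`-function of the good ordinary TWIST `E♭` (typed inputs `ChiBranchLeadingTerm…At`, then
theorems from the component reading-facts A124/A125, `GordRankZeroKatoComponent.lean`). On the
defect-`3,4,6` rows (Kodaira `IV/IV*`, `III/III*`, `II/II*`; 599 of the 1280 (G)-ord pairs at
`N < 2·10⁴`: 566 X4 + 33 X3) there is NO twist curve over `ℚ`: the untwisted object is Delbourgo's
newform `f̃ ∈ S₂(Ñ, ε²)` with `p ∣ Ñ` (Compositio 113, §1.5: "`p ∣ Ñ` if and only if `d = 3, 4` or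
`6`"), a `p`-NEW `p`-ordinary form with nebentypus of conductor `p`. This file isolates the ONE
statement the Iwasawa route needs at `T = 0` on ANY additive row of type (G)-ordinary or (M), in a
form that mentions neither a twist nor a branch:

* `CycLeadingTermAt W p` (TYPED, §0): for the cyclotomic `ℤ_p`-extension and every Pontryagin-dual
  datum `D` of the classical `Sel_{p^∞}(E/ℚ_∞)`, SOME `g ∈ char_Λ X(E/ℚ_∞)` has constant term
  `g(0) = u · (L(E,1)/Ω_E)` with `u ∈ ℤ_p^×` (and `L(E,1)/Ω_E ∈ ℚ`). This is the divisibility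
  ("Euler-system") direction of Delbourgo's Main Conjecture (G)/(M) [Compositio 113 (1998) p. 151:
  "`ε(T) G_E(T) = ℓ_p(E) · ∫ (1+T)^{x_p(g)} dμ_E`"] SPECIALISED AT `T = 0`, with the local invariant
  `ℓ_p(E)` a `p`-adic unit (see the reading note below).
* CONSUMER (§1, class-agnostic core `shaOrder_le_of_cycLeadingTerm`; §2 class forms): for `W`
  additive at an odd `p`, (G)-ordinary or potentially multiplicative, `r_an = 0`:
  `CycLeadingTermAt W p` + Delbourgo 1998 Prop. 4 (named fact `hDel`, weaker-than-print transcription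
  `prop4_rankZero_pow_dvd_constantCoeff`) + Gross–Zagier–Kolyvagin + modularity ⟹
  `ord_p #Ш(E) ≤ ord_p #Ш_an(E) + ord_p c_p(E)`, hence `Typed.MissingUpperBoundAt W p` as soon as
  `p ∤ c_p(E)` (automatic for `p ≥ 5`, Kodaira–Néron `c_p ≤ 4`): on the WHOLE (G)-ordinary cell
  (`ClassX4Gord.missingUpperBoundAt_rankZero_of_cycLeadingTerm`, `ClassX3Gord.…`, every defect,
  `p ≥ 5`; NO image / Tamagawa / Manin hypothesis), `BSD(E,p)` on the `p ∤ #Ш_an` rows, and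
  "what remains is EXACTLY the lower half" (`…missingInputAt_iff_lower…`).
* DISCHARGE ON DEFECT 2 (§3): the pointwise `χ_p`-branch leading terms of additive-p4's lines V9/V9b
  (`g(0) = u·ϖ·∑(a/p)[a/p]^±_{f♭}`) IMPLY `CycLeadingTermAt W p` — by Birch's formula and Pal's
  period relation in the tree's form `L(E,1) = ±ϖ·(∑…)·Ω_E` (`entireLFunction_one_eq_of_twist`, resp.
  `…_of_twist_neg` with the unit `|u(C)|·c_∞`); hence (§4) `CycLeadingTermAt W p` is a THEOREM on
  X4♯(G-ord) ∩ `I₀*` ∩ {`ρ̄` onto} (`p ≥ 5`) from the Kato component reading A124 and on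
  X3♯(G-ord) ∩ `I₀*` (odd `p`) from the Wuthrich component reading A125 — so the new predicate is
  the common generalisation of the four discharged branch inputs, and gen 12's consumers factor
  through it.

## The located gap on the defect-`3,4,6` rows (literature, gen 13; pages read)

`CycLeadingTermAt W p` for `(E,p)` with `e_E(p) ∈ {3,4,6}` is NOT in print as a theorem:
* Kato, Astérisque 295 (2004), Thm. 17.4 is stated under "`f` has good ordinary reduction at `λ`",
  which by Prop. 17.1 (p. 272, (i)) means "`p` does not divide `N` and `a_p ∈ O_λ^×`" — it covers the
  good ordinary twist `E♭` (defect 2) and NOT the `p`-new form `f̃` (defect `3,4,6`);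
  Skinner–Urban, Invent. Math. 195 (2014) Thm. 3.5.6 (Kato) likewise "Suppose `p ∤ N_f`".
* Emerton–Pollack–Weston, Invent. Math. 163 (2006) Thm. 5.1.2 states, for every `p`-ordinary
  `p`-stabilised newform `f` in a Hida family with irreducible `ρ̄` and every `ω^i`, "there is a
  `u ∈ Λ_O ⊗ ℚ_p` such that `L_p^{alg}(f,ω^i) · u = L_p^{an}(f,ω^i)`", attributing it to Kato: a
  RATIONAL divisibility (no constant-term inequality without `μ = 0`) and, for `p`-new members, an
  attribution without a printed proof.
* Kim–Nakamura, J. Number Theory (2020), Rem. 1.8 (3): "there is neither a Mazur–Greenberg style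
  main conjecture nor a control theorem for the additive reduction case" (their Thm. 1.6/1.7 are
  per-pair Kurihara-number criteria, class X4 only, Manin hypothesis) — Delbourgo 1998/2002 are
  cited there as "attempts".
* The canonical-vs-Néron period comparison for `f̃` (the defect-`3,4,6` analogue of Pal's theorem)
  is not in print either; the LOWER half is Skinner–Urban Thm. 3.6.1 only for trivial family
  character (`χ_f = 1`), which excludes the family of `f̃` (character `ω^{2a} ≠ 1`).
So on X4♯(G-ord)/X3♯(G-ord) ∩ {`e ≥ 3`} at rank `0` the class-level residue is {`CycLeadingTermAt`, the lower
half}; per pair these rows are reached by Kim 2026 Thm. 1.8 / Kurihara numbers (unit `additive-p3`).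

READING NOTE (Delbourgo 1998 §2.2 Lemma (i), p. 139, and `ℓ_p(E)`, p. 151). The Lemma computes
`#H¹(ℚ_{∞,p}/ℚ_p, E(ℚ_{∞,p}))(p) = #F(𝔽_p)(p) · #R(E(ℚ_p))(p)` with `F` the reduction of `E` over
the (G)-field `L` and `R` the reduction map on `E(L)`; in the proof (p. 141) `F(𝔽_p)` is a
`Gal(ℚ_p(μ_{p^∞})/ℚ_p)`-module through the INERTIA-TWISTED action (the good model lives over `L`, and
`Δ = Gal(L/ℚ_p)` acts on the special fibre through the automorphism of order `e`: `[−1]`, `[ζ₃]`,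
`[i]`, `[ζ₆]`), and only the `Δ`-invariants survive on `p`-parts (`p ∤ #Δ`). That automorphism acts
on the cyclic group `Ẽ(𝔽̄_p)[p^∞]` by a NONTRIVIAL `e`-th root of unity (it acts on the formal group
by a primitive one and has determinant `1`), so the `p`-part of the twisted invariants is trivial and
`ℓ_p(E) = #F(𝔽_p)·#R(E(ℚ_p))·c_p` is a `p`-adic UNIT on the whole (G)-cell for `p ≥ 5`. Two checks:
(a) for defect 2 the decomposition `E♭(L)/N = E(ℚ_p)/N ⊕ E♭(ℚ_p)/N` under `Gal(L/ℚ_p)` (both of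
order `#Ẽ♭(𝔽_p)(p)²`, residue field `𝔽_p` on both sides) gives `#H¹ = 1` directly; (b) read
LITERALLY (`F(𝔽_p) = Ẽ_L(𝔽_p)` untwisted) the Lemma would give `#H¹ ≥ p` on every defect-2 row whose
twist `E♭` is anomalous (`a_p(E♭) ≡ 1 (mod p)`; 89 X4♯(G-ord) ∩ `I₀*` rank-0 pairs at `N < 2·10⁴`,
additive-p2 census gen 11), and then Kato 17.4 (3) on the `χ_p`-component + the kernel transport [C]
(whose transported element has constant term of valuation EXACTLY `ord_p(L(E,1)/Ω_E)`, §3 below) would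
force `ord_p #Ш(E) ≤ ord_p #Ш_an(E) − 1` there — absurd on the `p ∤ #Ш_an` rows. The tree's
transcription of Prop. 4 (`prop4_rankZero_pow_dvd_constantCoeff`) DROPS the `H¹`-factor (uses only
`#H¹ ≥ 1`), so it is correct under either reading, and every consumer below is unaffected; the note
matters for any future EXACT transcription of Prop. 4 (lower-half direction) and fixes the shape of
the typed input: NO `ℓ_p`-factor.

References: D. Delbourgo, Compositio Math. 113 (1998) 123–154, §1.5, §2.2 Lemma, Thm. 3, Prop. 4,
Main Conjecture p. 151, remark p. 152 [Delbourgo1998]; K. Kato, Astérisque 295 (2004) Prop. 17.1,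
Thm. 17.4 [Kato2004Asterisque]; C. Skinner, E. Urban, Invent. Math. 195 (2014) Thm. 3.5.6, 3.6.1
[SkinnerUrban2014]; M. Emerton, R. Pollack, T. Weston, Invent. Math. 163 (2006) Thm. 5.1.2
[EmertonPollackWeston2006]; C.-H. Kim, K. Nakamura, J. Number Theory 210 (2020) Rem. 1.8
[KimNakamura2020]; C. Wuthrich, Doc. Math. 19 (2014) Thm. 16 [Wuthrich2014]; A. Pal, Proc. AMS (2012)
Thm. 3.2 [Pal2012].
-/

noncomputable section

open scoped Classical MatrixGroups ModularForm NumberField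

open CongruenceSubgroup WeierstrassCurve NumberField Literature.NumberTheory.EllipticCurves
  Literature.NumberTheory.EllipticCurves.ModularForms
  Literature.NumberTheory.EllipticCurves.Rank1Residual
  Literature.NumberTheory.EllipticCurves.Rank1Residual.Typed
  IsDedekindDomain Rat.HeightOneSpectrum

namespace Summit.BirchSwinnertonDyer.Rank1Residual.Additive

/-! ### §0 The typed input: a cyclotomic leading term at `T = 0` -/

/-- **The cyclotomic leading term at `T = 0`, TYPED** (the rank-`0` missing input of the Iwasawa
route at an additive prime of type (G)-ordinary or (M), in its weakest usable form). For the globally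
minimal `W = E` and the prime `p`: for the cyclotomic `ℤ_p`-extension `κ` of `ℚ` with a topological
generator `γ` matching the cyclotomic variable and EVERY Pontryagin-dual datum `D` of the classical
Selmer group `Sel_{p^∞}(E/ℚ_∞)` (tree `SelmerDualData`, Delbourgo's `X_∞`), SOME element `g` of the
characteristic ideal `char_Λ X(E/ℚ_∞)` has constant term `g(0) = u · q` with `u ∈ ℤ_p^×` and
`q = L(E,1)/Ω_E ∈ ℚ` (`L(E,1) = q · Ω_E`). Shape = Delbourgo 1998 Main Conjecture (G)/(M) (p. 151),
divisibility direction, at `T = 0`, with `ℓ_p(E) ∈ ℤ_p^×` (module docstring, reading note). On the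
defect-2 rows it is a THEOREM (§3–§4: Kato 17.4 (3) / Wuthrich Thm. 16 on the `ω^{(p−1)/2}`-component
+ transport + Birch + Pal); on the defect-`3,4,6` rows it is NOT in print (module docstring). A
predicate on `(W, p)`; its universal closure is NOT asserted.
[cite: Delbourgo1998, Main Conjecture (p. 151) (shape only; nothing asserted)] -/
def CycLeadingTermAt (W : WeierstrassCurve ℚ) (p : ℕ) [Fact p.Prime] : Prop :=
  ∀ (κ : ZpExtension ℚ p) (γ : Field.absoluteGaloisGroup ℚ),
    κ.IsCyclotomic → κ.IsTopGenerator γ → IsCyclotomicVariable p γ →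
    ∀ D : W.SelmerDualData κ γ, ∃ g ∈ D.charIdeal, ∃ u : ℤ_[p]ˣ, ∃ q : ℚ,
      W.entireLFunction 1 = (q : ℂ) * (W.realPeriodRat : ℂ) ∧
      ((PowerSeries.constantCoeff g : ℤ_[p]) : ℚ_[p]) = ((u : ℤ_[p]) : ℚ_[p]) * (q : ℚ_[p])

/-- Unfolding lemma for `CycLeadingTermAt` (to apply the predicate as a function). -/
theorem cycLeadingTermAt_iff (W : WeierstrassCurve ℚ) (p : ℕ) [Fact p.Prime] :
    CycLeadingTermAt W p ↔
      ∀ (κ : ZpExtension ℚ p) (γ : Field.absoluteGaloisGroup ℚ),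
        κ.IsCyclotomic → κ.IsTopGenerator γ → IsCyclotomicVariable p γ →
        ∀ D : W.SelmerDualData κ γ, ∃ g ∈ D.charIdeal, ∃ u : ℤ_[p]ˣ, ∃ q : ℚ,
          W.entireLFunction 1 = (q : ℂ) * (W.realPeriodRat : ℂ) ∧
          ((PowerSeries.constantCoeff g : ℤ_[p]) : ℚ_[p]) = ((u : ℤ_[p]) : ℚ_[p]) * (q : ℚ_[p]) :=
  Iff.rfl

variable (W : WeierstrassCurve ℚ) [W.IsElliptic] [W.IsGloballyMinimal] (p : ℕ) [hp : Fact p.Prime]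

/-! ### §1 The class-agnostic consumer: Delbourgo Prop. 4 + the leading term ⟹ the upper half -/

/-- **Core (rank `0`, any additive `p ≠ 2` of type (G)-ordinary or (M)).** For `E = W` globally
minimal, additive at the odd prime `p`, with (G)-ordinary (`TypeGOrd W p`) or potentially
multiplicative (`ord_p j < 0`) reduction and `ord_{s=1} L(E,s) = 0`: the typed input
`CycLeadingTermAt W p` together with Delbourgo 1998 Prop. 4 (named fact `hDel`:
`p^{ord #Ш(p) + ord ∏_{ℓ≠p} c_ℓ} ∣ g(0)·#E(ℚ)²` for every `g ∈ char X(E/ℚ_∞)`), Gross–Zagier–Kolyvagin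
(`hGZK`: `E(ℚ)`, `Ш` finite; `#Ш_an = (L(E,1)/Ω_E)·#E(ℚ)²/∏ c_ℓ`) and modularity (`hmod`:
`L(E,1) ≠ 0`) gives `#Ш_an(E) = q ∈ ℚ` with **`ord_p #Ш(E) ≤ ord_p q + ord_p c_p(E)`** (the torsion
terms cancel exactly; the Tamagawa numbers away from `p` cancel exactly).
[cite: Delbourgo1998, Prop. 4 (p. 144)] -/
theorem shaOrder_le_of_cycLeadingTerm
    (hDel : Delbourgo1998.prop4_rankZero_pow_dvd_constantCoeff)
    (hGZK : rank_eq_analyticRank_of_analyticRank_le_one) (hmod : hasEntireLFunction_rat)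
    (hp2 : p ≠ 2) (hadd : Addv W p) (hGM : TypeGOrd W p ∨ padicValRat p W.j < 0)
    (hr : W.analyticRank = 0) (hLT : CycLeadingTermAt W p) :
    ∃ q : ℚ, shaAn W = (q : ℂ) ∧
      (padicValNat p W.shaOrder : ℤ) ≤
        padicValRat p q + padicValNat p (W.tamagawaNumberAt ((primesEquiv (R := 𝓞 ℚ)).symm ⟨p, hp.out⟩)) := by
  classical
  have hpP : p.Prime := hp.out
  set v₀ : HeightOneSpectrum (𝓞 ℚ) := (primesEquiv (R := 𝓞 ℚ)).symm ⟨p, hp.out⟩ with hv₀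
  -- rank 0: `L(E,1) ≠ 0`, `E(ℚ)` and `Ш` finite
  have hL : W.entireLFunction 1 ≠ 0 := (W.analyticRank_eq_zero_iff_holds (hmod W)).mp hr
  obtain ⟨hmw, hfin⟩ := hGZK W (by rw [hr]; exact zero_le_one)
  have hmw0 : W.mordellWeilRank = 0 := by rw [hmw, hr]
  haveI : Finite W.sha := hfin
  haveI hE : Finite W.toAffine.Point := W.finite_point_of_rank_zero hmw0
  -- the cyclotomic setting and `X(E/ℚ_∞)`
  obtain ⟨κ, hκ, γ, hγ, hγ'⟩ := exists_isCyclotomic_isTopGenerator_isCyclotomicVariable_holds p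
  obtain ⟨D⟩ := W.nonempty_selmerDualData_holds κ γ hγ
  -- the typed input: an element of the characteristic ideal with constant term `u · L(E,1)/Ω_E`
  obtain ⟨g, hgmem, u, q, hLq, hg0⟩ := hLT κ γ hκ hγ hγ' D
  -- [A]: Delbourgo 1998 Prop. 4 (hypothesis (G)-ordinary in its global form, or (M))
  have hGM' := hGM.imp_left (fun hG ↦ hG)
  obtain ⟨-, hdiv⟩ := hDel W p hp2 hadd hGM' hr hfin hE κ γ hκ hγ D
  have hdvd := hdiv g hgmem
  -- `#Ш_an = q · #E(ℚ)² / ∏ c_ℓ`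
  have hΩ : (W.realPeriodRat : ℂ) ≠ 0 := by exact_mod_cast W.realPeriodRat_pos_holds.ne'
  have hq' : W.entireLFunction 1 / (W.realPeriodRat : ℂ) = (q : ℂ) := by
    rw [hLq, mul_div_cancel_right₀ _ hΩ]
  obtain ⟨-, -, -, hshaAn⟩ := Wuthrich2014.shaAn_eq_of_L_one_div_eq hGZK W hL hq'
  have hq0 : q ≠ 0 := by
    intro h0
    apply hL
    rw [hLq, h0, Rat.cast_zero, zero_mul]
  -- names for the arithmetic quantities
  set T : ℕ := Nat.card W.toAffine.Point with hT
  set c : ℕ := W.tamagawaNumberAt v₀ with hc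
  set P' : ℕ := ∏ᶠ v : HeightOneSpectrum (𝓞 ℚ),
    (if (p : 𝓞 ℚ) ∈ v.asIdeal then 1 else W.tamagawaNumberAt v) with hP'
  have hT0 : T ≠ 0 := by rw [hT]; exact Nat.card_pos.ne'
  have hPsplit : W.tamagawaProduct = c * P' := tamagawaProduct_eq_tamagawaNumberAt_mul_finprod W p
  have hPpos : 0 < W.tamagawaProduct := W.tamagawaProduct_pos_holds
  have hc0 : c ≠ 0 := fun h ↦ by rw [hPsplit, h, zero_mul] at hPpos; exact lt_irrefl 0 hPpos
  have hP'0 : P' ≠ 0 := fun h ↦ by rw [hPsplit, h, mul_zero] at hPpos; exact lt_irrefl 0 hPpos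
  have hvP : padicValNat p W.tamagawaProduct = padicValNat p c + padicValNat p P' := by
    rw [hPsplit, padicValNat.mul hc0 hP'0]
  have hsha : padicValNat p (Nat.card (AddCommGroup.primaryComponent W.sha p)) =
      padicValNat p W.shaOrder := by
    unfold WeierstrassCurve.shaOrder
    exact padicValNat_card_addPrimaryComponent p
  -- the divisibility in `ℤ_p`, read as an inequality of valuations in `ℚ_p`
  set g0 : ℚ_[p] := ((PowerSeries.constantCoeff g : ℤ_[p]) : ℚ_[p]) with hg0def
  have hqQ : ((q : ℚ) : ℚ_[p]) ≠ 0 := by exact_mod_cast hq0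
  have hg0ne : g0 ≠ 0 := by
    rw [hg0]
    exact mul_ne_zero (coe_units_ne_zero p u) hqQ
  have hvg0 : g0.valuation = padicValRat p q := by
    rw [hg0, Padic.valuation_mul (coe_units_ne_zero p u) hqQ, valuation_coe_units_eq_zero,
      zero_add, Padic.valuation_ratCast]
  have hTQ : ((T : ℕ) : ℚ_[p]) ≠ 0 := by exact_mod_cast hT0
  obtain ⟨c', hc'⟩ := hdvd
  have hkey : g0 * ((T : ℕ) : ℚ_[p]) ^ 2 =
      (p : ℚ_[p]) ^ (padicValNat p (Nat.card (AddCommGroup.primaryComponent W.sha p)) +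
        padicValNat p P') * ((c' : ℤ_[p]) : ℚ_[p]) := by
    have h := congrArg ((↑) : ℤ_[p] → ℚ_[p]) hc'
    push_cast at h
    rw [hg0def]
    exact h
  have hlhs0 : g0 * ((T : ℕ) : ℚ_[p]) ^ 2 ≠ 0 := mul_ne_zero hg0ne (pow_ne_zero 2 hTQ)
  have hc'0 : ((c' : ℤ_[p]) : ℚ_[p]) ≠ 0 := by
    intro h0
    rw [h0, mul_zero] at hkey
    exact hlhs0 hkey
  have hpQ : (p : ℚ_[p]) ≠ 0 := by exact_mod_cast hpP.ne_zero
  have hval := congrArg Padic.valuation hkey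
  rw [Padic.valuation_mul hg0ne (pow_ne_zero 2 hTQ), Padic.valuation_pow, Padic.valuation_natCast,
    hvg0, Padic.valuation_mul (pow_ne_zero _ hpQ) hc'0, Padic.valuation_pow, Padic.valuation_p,
    mul_one, hsha] at hval
  have hc'val : 0 ≤ (((c' : ℤ_[p]) : ℚ_[p])).valuation := PadicInt.valuation_coe_nonneg
  -- (**) `ord_p #Ш + ord_p P' ≤ ord_p q + 2 ord_p T`
  have hineq : (padicValNat p W.shaOrder : ℤ) + padicValNat p P' ≤
      padicValRat p q + 2 * (padicValNat p T : ℤ) := by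
    simp only [Nat.cast_add, Nat.cast_ofNat] at hval
    linarith
  -- conclusion: `ord_p #Ш ≤ ord_p(q T²/∏ c_ℓ) + ord_p c_p = ord_p q + 2 ord_p T − ord_p P'`
  refine ⟨q * (T : ℚ) ^ 2 / (W.tamagawaProduct : ℚ), ?_, ?_⟩
  · rw [hshaAn]
  · have hTq : (T : ℚ) ≠ 0 := by exact_mod_cast hT0
    have hPq : (W.tamagawaProduct : ℚ) ≠ 0 := by exact_mod_cast hPpos.ne'
    rw [padicValRat.div (mul_ne_zero hq0 (pow_ne_zero 2 hTq)) hPq,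
      padicValRat.mul hq0 (pow_ne_zero 2 hTq), padicValRat.pow, padicValRat.of_nat,
      padicValRat.of_nat, hvP]
    simp only [Nat.cast_ofNat, Nat.cast_add]
    linarith

/-- **The upper half from the cyclotomic leading term when `p ∤ c_p(E)`.** In the setting of
`shaOrder_le_of_cycLeadingTerm`, if `p ∤ c_p(E)` then `Typed.MissingUpperBoundAt W p`
(`ord_p #Ш(E) ≤ ord_p #Ш_an(E)`). [cite: Delbourgo1998, Prop. 4 (p. 144)] -/
theorem missingUpperBoundAt_of_cycLeadingTerm
    (hDel : Delbourgo1998.prop4_rankZero_pow_dvd_constantCoeff)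
    (hGZK : rank_eq_analyticRank_of_analyticRank_le_one) (hmod : hasEntireLFunction_rat)
    (hp2 : p ≠ 2) (hadd : Addv W p) (hGM : TypeGOrd W p ∨ padicValRat p W.j < 0)
    (hr : W.analyticRank = 0) (hLT : CycLeadingTermAt W p)
    (htam : ¬ p ∣ W.tamagawaNumberAt ((primesEquiv (R := 𝓞 ℚ)).symm ⟨p, hp.out⟩)) :
    MissingUpperBoundAt W p := by
  obtain ⟨q, hq, hle⟩ := shaOrder_le_of_cycLeadingTerm W p hDel hGZK hmod hp2 hadd hGM hr hLT
  refine ⟨q, hq, ?_⟩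
  rw [padicValNat.eq_zero_of_not_dvd htam, Nat.cast_zero, add_zero] at hle
  exact hle

/-- **The upper half from the cyclotomic leading term at every additive `p ≥ 5`** of type
(G)-ordinary or (M) (`c_p(E) ≤ 4 < p` by Kodaira–Néron, tree theorem
`padicValNat_tamagawaNumberAt_eq_zero_of_addv`). [cite: Delbourgo1998, Prop. 4 (p. 144)] -/
theorem missingUpperBoundAt_of_cycLeadingTerm_of_five_le
    (hDel : Delbourgo1998.prop4_rankZero_pow_dvd_constantCoeff)
    (hGZK : rank_eq_analyticRank_of_analyticRank_le_one) (hmod : hasEntireLFunction_rat)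
    (hp5 : 5 ≤ p) (hadd : Addv W p) (hGM : TypeGOrd W p ∨ padicValRat p W.j < 0)
    (hr : W.analyticRank = 0) (hLT : CycLeadingTermAt W p) :
    MissingUpperBoundAt W p := by
  obtain ⟨q, hq, hle⟩ :=
    shaOrder_le_of_cycLeadingTerm W p hDel hGZK hmod (by omega) hadd hGM hr hLT
  refine ⟨q, hq, ?_⟩
  rw [padicValNat_tamagawaNumberAt_eq_zero_of_addv W p hadd hp5, Nat.cast_zero, add_zero] at hle
  exact hle

variable {W p}

/-! ### §2 The (G)-ordinary cell, EVERY defect, `p ≥ 5`: the class forms -/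

/-- **X4♯(G-ord), ANY defect `e ∈ {2,3,4,6}`, `p ≥ 5`, `r_an = 0`: the UPPER half
`ord_p #Ш(E) ≤ ord_p #Ш_an(E)` from the typed cyclotomic leading term `CycLeadingTermAt W p`
ALONE** (other inputs: Delbourgo 1998 Prop. 4 `hDel`, GZK, modularity). NO image, Tamagawa or Manin
hypothesis. On the defect-2 rows the input is a theorem (§4); on the defect-`3,4,6` rows it is the
located gap (module docstring). X4♯(G-ord) stays CONSTRUCTION-SHAPED. [cite: Delbourgo1998, Prop. 4 (p. 144)] -/
theorem ClassX4Gord.missingUpperBoundAt_rankZero_of_cycLeadingTerm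
    (hDel : Delbourgo1998.prop4_rankZero_pow_dvd_constantCoeff)
    (hGZK : rank_eq_analyticRank_of_analyticRank_le_one) (hmod : hasEntireLFunction_rat)
    (hX : ClassX4Gord W p) (hp5 : 5 ≤ p) (hr : W.analyticRank = 0) (hLT : CycLeadingTermAt W p) :
    MissingUpperBoundAt W p :=
  missingUpperBoundAt_of_cycLeadingTerm_of_five_le W p hDel hGZK hmod hp5 hX.addv.2
    (Or.inl hX.typeGOrd) hr hLT

/-- **X4♯(G-ord), any defect, `p ≥ 5`, `r_an = 0`, `p ∤ #Ш_an(E)`: `BSD(E,p)` from the typed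
cyclotomic leading term alone.** [cite: Delbourgo1998, Prop. 4 (p. 144)] -/
theorem ClassX4Gord.bsdp_rankZero_of_cycLeadingTerm_of_shaAn_unit
    (hDel : Delbourgo1998.prop4_rankZero_pow_dvd_constantCoeff)
    (hGZK : rank_eq_analyticRank_of_analyticRank_le_one) (hmod : hasEntireLFunction_rat)
    (hX : ClassX4Gord W p) (hp5 : 5 ≤ p) (hr : W.analyticRank = 0) (hLT : CycLeadingTermAt W p)
    {q : ℚ} (hq : shaAn W = (q : ℂ)) (hv : padicValRat p q = 0) : BSDp W p :=
  bsdp_of_missingPPartAt W p hGZK (by rw [hr]; exact zero_le_one)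
    (missingPPartAt_of_upper_of_shaAn_unit W p
      (ClassX4Gord.missingUpperBoundAt_rankZero_of_cycLeadingTerm hDel hGZK hmod hX hp5 hr hLT) hq hv)

/-- **X4♯(G-ord), any defect, `p ≥ 5`, `r_an = 0`: what remains, granted the cyclotomic leading
term, is EXACTLY the lower half over `ℚ`** (`Typed.X4.MissingInputAt W p ↔ MissingLowerBoundAt W p`).
[cite: Delbourgo1998, Prop. 4 (p. 144)] -/
theorem ClassX4Gord.missingInputAt_iff_lower_rankZero_of_cycLeadingTerm
    (hDel : Delbourgo1998.prop4_rankZero_pow_dvd_constantCoeff)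
    (hGZK : rank_eq_analyticRank_of_analyticRank_le_one) (hmod : hasEntireLFunction_rat)
    (hX : ClassX4Gord W p) (hp5 : 5 ≤ p) (hr : W.analyticRank = 0) (hLT : CycLeadingTermAt W p) :
    X4.MissingInputAt W p ↔ MissingLowerBoundAt W p :=
  ⟨fun h ↦ (lower_and_upper_of_missingPPartAt W p h).1, fun h ↦
    missingPPartAt_of_lower_of_upper W p h
      (ClassX4Gord.missingUpperBoundAt_rankZero_of_cycLeadingTerm hDel hGZK hmod hX hp5 hr hLT)⟩

/-- **X4♯(G-ord), any defect, `p ≥ 5`, `r_an = 0`: `BSD(E,p)` from the cyclotomic leading term and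
the LOWER half over `ℚ`.** [cite: Delbourgo1998, Prop. 4 (p. 144)] -/
theorem ClassX4Gord.bsdp_rankZero_of_cycLeadingTerm_of_lower
    (hDel : Delbourgo1998.prop4_rankZero_pow_dvd_constantCoeff)
    (hGZK : rank_eq_analyticRank_of_analyticRank_le_one) (hmod : hasEntireLFunction_rat)
    (hX : ClassX4Gord W p) (hp5 : 5 ≤ p) (hr : W.analyticRank = 0) (hLT : CycLeadingTermAt W p)
    (hlow : MissingLowerBoundAt W p) : BSDp W p :=
  bsdp_of_missingPPartAt W p hGZK (by rw [hr]; exact zero_le_one)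
    ((ClassX4Gord.missingInputAt_iff_lower_rankZero_of_cycLeadingTerm hDel hGZK hmod hX hp5 hr
      hLT).mpr hlow)

/-- **X3♯(G-ord), ANY defect, `p ≥ 5`, `r_an = 0`: the UPPER half from the typed cyclotomic leading
term alone.** X3♯(G-ord) stays CONSTRUCTION-SHAPED. [cite: Delbourgo1998, Prop. 4 (p. 144)] -/
theorem ClassX3Gord.missingUpperBoundAt_rankZero_of_cycLeadingTerm
    (hDel : Delbourgo1998.prop4_rankZero_pow_dvd_constantCoeff)
    (hGZK : rank_eq_analyticRank_of_analyticRank_le_one) (hmod : hasEntireLFunction_rat)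
    (hX : ClassX3Gord W p) (hp5 : 5 ≤ p) (hr : W.analyticRank = 0) (hLT : CycLeadingTermAt W p) :
    MissingUpperBoundAt W p :=
  missingUpperBoundAt_of_cycLeadingTerm_of_five_le W p hDel hGZK hmod hp5 hX.addv (Or.inl hX.typeGOrd)
    hr hLT

/-- **X3♯(G-ord), any defect, `p ≥ 5`, `r_an = 0`, `p ∤ #Ш_an(E)`: `BSD(E,p)` from the typed
cyclotomic leading term alone.** [cite: Delbourgo1998, Prop. 4 (p. 144)] -/
theorem ClassX3Gord.bsdp_rankZero_of_cycLeadingTerm_of_shaAn_unit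
    (hDel : Delbourgo1998.prop4_rankZero_pow_dvd_constantCoeff)
    (hGZK : rank_eq_analyticRank_of_analyticRank_le_one) (hmod : hasEntireLFunction_rat)
    (hX : ClassX3Gord W p) (hp5 : 5 ≤ p) (hr : W.analyticRank = 0) (hLT : CycLeadingTermAt W p)
    {q : ℚ} (hq : shaAn W = (q : ℂ)) (hv : padicValRat p q = 0) : BSDp W p :=
  bsdp_of_missingPPartAt W p hGZK (by rw [hr]; exact zero_le_one)
    (missingPPartAt_of_upper_of_shaAn_unit W p
      (ClassX3Gord.missingUpperBoundAt_rankZero_of_cycLeadingTerm hDel hGZK hmod hX hp5 hr hLT) hq hv)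

/-- **X3♯(G-ord), any defect, `p ≥ 5`, `r_an = 0`: what remains, granted the cyclotomic leading
term, is EXACTLY the lower half over `ℚ`** (`Gord.MissingInputAt W p ↔ MissingLowerBoundAt W p`).
[cite: Delbourgo1998, Prop. 4 (p. 144)] -/
theorem ClassX3Gord.missingInputAt_iff_lower_rankZero_of_cycLeadingTerm
    (hDel : Delbourgo1998.prop4_rankZero_pow_dvd_constantCoeff)
    (hGZK : rank_eq_analyticRank_of_analyticRank_le_one) (hmod : hasEntireLFunction_rat)
    (hX : ClassX3Gord W p) (hp5 : 5 ≤ p) (hr : W.analyticRank = 0) (hLT : CycLeadingTermAt W p) :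
    Gord.MissingInputAt W p ↔ MissingLowerBoundAt W p :=
  ⟨fun h ↦ (lower_and_upper_of_missingPPartAt W p h).1, fun h ↦
    missingPPartAt_of_lower_of_upper W p h
      (ClassX3Gord.missingUpperBoundAt_rankZero_of_cycLeadingTerm hDel hGZK hmod hX hp5 hr hLT)⟩

end Summit.BirchSwinnertonDyer.Rank1Residual.Additive

end
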